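import Summits.HubbardSuperconductivity.HubbardSuperconductivity.Theorems.ThermalWedgeTwSourcedInertnessReduction

/-!
# Crux `TwSeededEnsembleEquivalence` (stmt-HubbardSuperconductivity-1698), thermal line — the
# infinite-volume SEEDED pressure from the infinite-volume SOURCED pressure

Support file (`--supports stmt-HubbardSuperconductivity-1698`; no definition, nothing assumed).
Hypothesis (TDL) of `tw_seededSecantBracket_of_differentiableLimit`
(`…BracketOfDifferentiableLimit.lean`) asks the pointwise thermodynamic limit of the SEEDED (mean-field)
pressure `p_L(β,μ) = log Re Z(β, K_L(μ))/(βL²)`, `K_L(μ) = hubbardTorusWith 2 L 1 U μ − (g/L²)P_L`. This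
file reduces it to the thermodynamic limit of the SHORT-RANGE SOURCED pressure
`p̃_L(β,μ,h) = log Re Z(β, dWaveSourceTorus L U μ h)/(βL²)` on the compact source interval
`|h| ≤ H := 13g + 1`, through the approximating-Hamiltonian theorem (item 1703, hypothesis `hAHM` =
its body at `(U, μ, β, g)`): if `p̃_L(β,μ,h) → q(h)` for every `|h| ≤ H`, then
`p_L(β,μ) → b := sup_{|h| ≤ H} [q(h) − h²/g]`.
Proof: the sourced pressure is `8√2`-Lipschitz in `h` uniformly in `L` (tree
`abs_sourcedPressure_sub_le`), so the convergence is uniform on `[−H, H]` (finite grid) and `q` is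
Lipschitz; every AHM near-maximiser `h_L` (slack `≤ 1/3`) has `|h_L| ≤ H` (`h_L²/g ≤ 8√2|h_L| + 1/3` from
the easy half at `h = 0`); upper bound from the hard half at `h_L` and the grid, lower bound from the easy
half at a near-maximiser of `q(h) − h²/g`. Bogoliubov Jr.–Brankov–Zagrebnov–Kurbatov–Tonchev (1984)
Thm (ii); Bru–de Siqueira Pedra (2013) §10.2. [folklore]
-/

set_option linter.dupNamespace false

namespace Summit.HubbardSuperconductivity.HubbardSuperconductivity.Theorems.TwSeededEnsembleEquivalence.ThermalDuality

open Matrix Filter Topology Finset Literature.MathematicalPhysics.QuantumLattice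
open Summit.HubbardSuperconductivity.HubbardSuperconductivity.Theorems
open scoped ComplexOrder Matrix.Norms.L2Operator

noncomputable section

/-- `8√2 ≤ 12`. [folklore] -/
private theorem eight_sqrt_two_le : 8 * Real.sqrt 2 ≤ 12 := by
  have h : Real.sqrt 2 ≤ 3 / 2 := by
    rw [Real.sqrt_le_left (by norm_num)]
    norm_num
  linarith

/-- **Grid lemma**: for `s > 0` and `h ∈ [−H, H]`, the grid point `−H + ⌊(h+H)/s⌋₊·s` lies in
`[−H, H]`, within `s` below `h`, and its index is at most `⌊2H/s⌋₊`. [folklore] -/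
private theorem grid_point {H s h : ℝ} (hs : 0 < s) (hh : h ∈ Set.Icc (-H) H) :
    ⌊(h + H) / s⌋₊ ≤ ⌊2 * H / s⌋₊ ∧ (-H + ⌊(h + H) / s⌋₊ * s) ∈ Set.Icc (-H) H ∧
      0 ≤ h - (-H + ⌊(h + H) / s⌋₊ * s) ∧ h - (-H + ⌊(h + H) / s⌋₊ * s) ≤ s := by
  have h0 : 0 ≤ (h + H) / s := div_nonneg (by linarith [hh.1]) hs.le
  have hfl : (⌊(h + H) / s⌋₊ : ℝ) ≤ (h + H) / s := Nat.floor_le h0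
  have hlt : (h + H) / s < ⌊(h + H) / s⌋₊ + 1 := Nat.lt_floor_add_one _
  have h1 : (⌊(h + H) / s⌋₊ : ℝ) * s ≤ h + H := by
    have := mul_le_mul_of_nonneg_right hfl hs.le
    rwa [div_mul_cancel₀ _ hs.ne'] at this
  have h2 : h + H < ((⌊(h + H) / s⌋₊ : ℝ) + 1) * s := by
    have := mul_lt_mul_of_pos_right hlt hs
    rwa [div_mul_cancel₀ _ hs.ne'] at this
  refine ⟨Nat.floor_mono (div_le_div_of_nonneg_right (by linarith [hh.2]) hs.le), ⟨?_, ?_⟩, ?_, ?_⟩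
  · have : (0 : ℝ) ≤ ⌊(h + H) / s⌋₊ * s := mul_nonneg (Nat.cast_nonneg _) hs.le
    linarith
  · linarith [hh.2]
  · linarith
  · nlinarith

/-- **THE INFINITE-VOLUME SEEDED PRESSURE FROM THE INFINITE-VOLUME SOURCED PRESSURE** (pointwise in
`(U, g, β, μ)`, `β, g > 0`). Assume the approximating-Hamiltonian theorem at `(U, μ, β, g)` (`hAHM`, the
body of item 1703: easy half for every `L, h`, hard half eventually in `L`) and the thermodynamic limit of
the sourced pressure on the source interval `|h| ≤ 13g + 1` (`hsl`: `p̃_L(β,μ,h) → q(h)` for each such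
`h`). Then the seeded pressure converges: `p_L(β,μ) → sup_{|h| ≤ 13g+1} [q(h) − h²/g]`. [folklore] -/
theorem tw_seededPressureLimit_of_sourcedLimit (U g β μ : ℝ) (q : ℝ → ℝ) (hβ : 0 < β) (hg : 0 < g)
    (hAHM : (∀ (L : ℕ) [NeZero L] (h : ℝ),
        (Real.log (Matrix.partitionFn β (dWaveSourceTorus L U μ h)).re / (β * (L : ℝ) ^ 2)) - h ^ 2 / g ≤
          (Real.log (Matrix.partitionFn β (hubbardTorusWith 2 L 1 U μ - ((g / (L : ℝ) ^ 2 : ℝ) : ℂ) •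
            ((pairField dWaveFormFactor L)ᴴ * pairField dWaveFormFactor L))).re / (β * (L : ℝ) ^ 2))) ∧
      (∀ ε : ℝ, 0 < ε → ∃ L₀ : ℕ, ∀ (L : ℕ) [NeZero L], L₀ ≤ L → ∃ h : ℝ,
        (Real.log (Matrix.partitionFn β (hubbardTorusWith 2 L 1 U μ - ((g / (L : ℝ) ^ 2 : ℝ) : ℂ) •
          ((pairField dWaveFormFactor L)ᴴ * pairField dWaveFormFactor L))).re / (β * (L : ℝ) ^ 2)) ≤
          (Real.log (Matrix.partitionFn β (dWaveSourceTorus L U μ h)).re / (β * (L : ℝ) ^ 2)) - h ^ 2 / g + ε))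
    (hsl : ∀ h ∈ Set.Icc (-(13 * g + 1)) (13 * g + 1), ∀ κ : ℝ, 0 < κ → ∃ L₀ : ℕ, ∀ (L : ℕ) [NeZero L],
      L₀ ≤ L → |Real.log (Matrix.partitionFn β (dWaveSourceTorus L U μ h)).re / (β * (L : ℝ) ^ 2) - q h| ≤ κ) :
    ∀ κ : ℝ, 0 < κ → ∃ L₀ : ℕ, ∀ (L : ℕ) [NeZero L], L₀ ≤ L →
      |Real.log (Matrix.partitionFn β (hubbardTorusWith 2 L 1 U μ - ((g / (L : ℝ) ^ 2 : ℝ) : ℂ) •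
          ((pairField dWaveFormFactor L)ᴴ * pairField dWaveFormFactor L))).re / (β * (L : ℝ) ^ 2) -
        sSup ((fun h : ℝ => q h - h ^ 2 / g) '' Set.Icc (-(13 * g + 1)) (13 * g + 1))| ≤ κ := by
  obtain ⟨hEasy, hHard⟩ := hAHM
  set H : ℝ := 13 * g + 1 with hHdef
  have hH : 0 < H := by positivity
  have h0mem : (0 : ℝ) ∈ Set.Icc (-H) H := ⟨by linarith, hH.le⟩
  set C : ℝ := 8 * Real.sqrt 2 with hCdef
  have hC0 : 0 ≤ C := by positivity
  have hC12 : C ≤ 12 := eight_sqrt_two_le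
  -- (1) the limit `q` is `C`-Lipschitz on `[−H, H]`
  have hqLip : ∀ h ∈ Set.Icc (-H) H, ∀ h' ∈ Set.Icc (-H) H, |q h - q h'| ≤ C * |h - h'| := by
    intro h hh h' hh'
    refine le_of_forall_pos_le_add fun κ hκ => ?_
    obtain ⟨L₁, hL₁⟩ := hsl h hh (κ / 2) (by positivity)
    obtain ⟨L₂, hL₂⟩ := hsl h' hh' (κ / 2) (by positivity)
    have e1 := hL₁ (max L₁ L₂ + 1) (by omega)
    have e2 := hL₂ (max L₁ L₂ + 1) (by omega)
    have e3 := abs_sourcedPressure_sub_le (max L₁ L₂ + 1) U μ hβ h h'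
    rw [abs_le] at e1 e2 e3 ⊢
    constructor <;> linarith [e1.1, e1.2, e2.1, e2.2, e3.1, e3.2]
  -- (2) the variational function and its supremum
  set Q : ℝ → ℝ := fun h => q h - h ^ 2 / g with hQdef
  have hQle : ∀ h ∈ Set.Icc (-H) H, Q h ≤ q 0 + C * H := by
    intro h hh
    have h1 := hqLip h hh 0 h0mem
    rw [sub_zero] at h1
    have h2 : |h| ≤ H := abs_le.2 ⟨hh.1, hh.2⟩
    have h3 : 0 ≤ h ^ 2 / g := by positivity
    have h4 : q h ≤ q 0 + C * H := by
      have := (abs_le.1 h1).2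
      linarith [mul_le_mul_of_nonneg_left h2 hC0]
    simp only [hQdef]
    linarith
  have hbdd : BddAbove (Q '' Set.Icc (-H) H) := by
    refine ⟨q 0 + C * H, ?_⟩
    rintro _ ⟨h, hh, rfl⟩
    exact hQle h hh
  have hne : (Q '' Set.Icc (-H) H).Nonempty := ⟨Q 0, Set.mem_image_of_mem _ h0mem⟩
  set b : ℝ := sSup (Q '' Set.Icc (-H) H) with hbdef
  have hQb : ∀ h ∈ Set.Icc (-H) H, Q h ≤ b := fun h hh => le_csSup hbdd (Set.mem_image_of_mem _ hh)
  -- (3) reduce to `κ ≤ 1`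
  suffices main : ∀ κ : ℝ, 0 < κ → κ ≤ 1 → ∃ L₀ : ℕ, ∀ (L : ℕ) [NeZero L], L₀ ≤ L →
      |Real.log (Matrix.partitionFn β (hubbardTorusWith 2 L 1 U μ - ((g / (L : ℝ) ^ 2 : ℝ) : ℂ) •
          ((pairField dWaveFormFactor L)ᴴ * pairField dWaveFormFactor L))).re / (β * (L : ℝ) ^ 2) - b| ≤ κ by
    intro κ hκ
    obtain ⟨L₀, hL₀⟩ := main (min κ 1) (lt_min hκ one_pos) (min_le_right _ _)
    exact ⟨L₀, fun L _ hL => (hL₀ L hL).trans (min_le_left _ _)⟩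
  intro κ hκ hκ1
  -- (4) lower bound: a near-maximiser `h⋆` of `Q` and the easy half there
  obtain ⟨_, ⟨hs, hhs, rfl⟩, hlt⟩ := exists_lt_of_lt_csSup hne (by linarith : b - κ / 2 < b)
  obtain ⟨L₁, hL₁⟩ := hsl hs hhs (κ / 2) (by positivity)
  -- (5) upper bound: grid for uniform convergence on `[−H, H]`
  set s : ℝ := κ / (3 * (C + 2 * H / g + 1)) with hsdef
  have hden : 0 < C + 2 * H / g + 1 := by positivity
  have hspos : 0 < s := by positivity
  have hsmall : (C + 2 * H / g) * s ≤ κ / 3 := by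
    rw [hsdef]
    rw [show (C + 2 * H / g) * (κ / (3 * (C + 2 * H / g + 1))) =
        (κ / 3) * ((C + 2 * H / g) / (C + 2 * H / g + 1)) by field_simp]
    have : (C + 2 * H / g) / (C + 2 * H / g + 1) ≤ 1 := by
      rw [div_le_one hden]; linarith
    have hκ3 : 0 ≤ κ / 3 := by positivity
    exact mul_le_of_le_one_right hκ3 this
  set n : ℕ := ⌊2 * H / s⌋₊ with hndef
  have hgrid : ∀ j : ℕ, ∃ L₀ : ℕ, j ≤ n → ∀ (L : ℕ) [NeZero L], L₀ ≤ L →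
      |Real.log (Matrix.partitionFn β (dWaveSourceTorus L U μ (-H + j * s))).re / (β * (L : ℝ) ^ 2) -
        q (-H + j * s)| ≤ κ / 3 := by
    intro j
    by_cases hj : j ≤ n
    · have hmem : (-H + j * s) ∈ Set.Icc (-H) H := by
        refine ⟨by linarith [mul_nonneg (Nat.cast_nonneg j : (0 : ℝ) ≤ j) hspos.le], ?_⟩
        have h1 : (j : ℝ) ≤ n := by exact_mod_cast hj
        have h2 : (n : ℝ) ≤ 2 * H / s := Nat.floor_le (by positivity)
        have h3 : (j : ℝ) * s ≤ 2 * H := by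
          have := mul_le_mul_of_nonneg_right (h1.trans h2) hspos.le
          rwa [div_mul_cancel₀ _ hspos.ne'] at this
        linarith
      obtain ⟨L₀, hL₀⟩ := hsl _ hmem (κ / 3) (by positivity)
      exact ⟨L₀, fun _ => hL₀⟩
    · exact ⟨0, fun h => absurd h hj⟩
  choose Lj hLj using hgrid
  obtain ⟨L₂, hL₂⟩ := hHard (κ / 3) (by positivity)
  refine ⟨max (max L₁ L₂) ((Finset.range (n + 1)).sup Lj), fun L _ hL => ?_⟩
  have hL1 : L₁ ≤ L := ((le_max_left _ _).trans (le_max_left _ _)).trans hL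
  have hL2 : L₂ ≤ L := ((le_max_right _ _).trans (le_max_left _ _)).trans hL
  -- abbreviate the two finite-volume pressures at this `L`
  set pL : ℝ := Real.log (Matrix.partitionFn β (hubbardTorusWith 2 L 1 U μ - ((g / (L : ℝ) ^ 2 : ℝ) : ℂ) •
      ((pairField dWaveFormFactor L)ᴴ * pairField dWaveFormFactor L))).re / (β * (L : ℝ) ^ 2) with hpLdef
  set ptL : ℝ → ℝ := fun h => Real.log (Matrix.partitionFn β (dWaveSourceTorus L U μ h)).re / (β * (L : ℝ) ^ 2)
    with hptLdef
  -- lower bound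
  have hlow : b - κ ≤ pL := by
    have e1 := hEasy L hs
    have e2 := abs_le.1 (hL₁ L hL1)
    change ptL hs - hs ^ 2 / g ≤ pL at e1
    change -(κ / 2) ≤ ptL hs - q hs ∧ ptL hs - q hs ≤ κ / 2 at e2
    have : Q hs = q hs - hs ^ 2 / g := rfl
    linarith [e2.1]
  -- upper bound
  have hup : pL ≤ b + κ := by
    obtain ⟨hL', hhL'⟩ := hL₂ L hL2
    change pL ≤ ptL hL' - hL' ^ 2 / g + κ / 3 at hhL'
    -- a priori bound on the near-maximiser
    have e0 : ptL 0 ≤ pL := by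
      have e00 := hEasy L 0
      have hz : (0 : ℝ) ^ 2 / g = 0 := by rw [zero_pow two_ne_zero, zero_div]
      change ptL 0 - 0 ^ 2 / g ≤ pL at e00
      linarith
    have eLip0 := abs_sourcedPressure_sub_le L U μ hβ hL' 0
    change |ptL hL' - ptL 0| ≤ 8 * Real.sqrt 2 * |hL' - 0| at eLip0
    rw [sub_zero, ← hCdef] at eLip0
    have hsq : hL' ^ 2 / g ≤ C * |hL'| + κ / 3 := by linarith [(abs_le.1 eLip0).2]
    have hsq' : |hL'| ^ 2 ≤ g * C * |hL'| + g * (κ / 3) := by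
      rw [sq_abs]
      have := mul_le_mul_of_nonneg_left hsq hg.le
      rwa [mul_div_cancel₀ _ hg.ne', mul_add, ← mul_assoc] at this
    have habs : |hL'| ≤ H := by
      by_contra hcon
      rw [not_le] at hcon
      have hx0 : 0 ≤ |hL'| := abs_nonneg _
      have hxpos : 0 < |hL'| := hH.trans hcon
      have h1 : g * C * |hL'| ≤ 12 * g * |hL'| :=
        mul_le_mul_of_nonneg_right (by nlinarith [mul_le_mul_of_nonneg_left hC12 hg.le]) hx0
      have h2 : g * (κ / 3) ≤ g := by nlinarith
      have h3 : (13 * g + 1) * |hL'| < |hL'| ^ 2 := by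
        rw [sq]; exact mul_lt_mul_of_pos_right hcon hxpos
      have h4 : (g + 1) * (13 * g + 1) < (g + 1) * |hL'| := mul_lt_mul_of_pos_left hcon (by linarith)
      have h5 : (13 * g + 1) * |hL'| = 12 * g * |hL'| + (g + 1) * |hL'| := by ring
      have h6 : (g + 1) * (13 * g + 1) = 13 * g ^ 2 + 14 * g + 1 := by ring
      nlinarith [hsq', h1, h2, h3, h4, h5, h6, sq_nonneg g]
    have hmem : hL' ∈ Set.Icc (-H) H := ⟨(abs_le.1 habs).1, (abs_le.1 habs).2⟩
    -- nearest grid point below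
    obtain ⟨hjn, hjmem, hj0, hjs⟩ := grid_point hspos hmem
    set j : ℕ := ⌊(hL' + H) / s⌋₊ with hjdef
    set hj : ℝ := -H + j * s with hhjdef
    have hLjL : Lj j ≤ L := by
      have h1 : Lj j ≤ (Finset.range (n + 1)).sup Lj :=
        Finset.le_sup (f := Lj) (Finset.mem_range.2 (Nat.lt_succ_of_le hjn))
      exact (h1.trans (le_max_right _ _)).trans hL
    have egrid := hLj j hjn L hLjL
    change |ptL hj - q hj| ≤ κ / 3 at egrid
    have eLip := abs_sourcedPressure_sub_le L U μ hβ hL' hj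
    change |ptL hL' - ptL hj| ≤ 8 * Real.sqrt 2 * |hL' - hj| at eLip
    rw [← hCdef, abs_of_nonneg hj0] at eLip
    have hsqdiff : hj ^ 2 / g - hL' ^ 2 / g ≤ 2 * H / g * s := by
      rw [← sub_div, div_mul_eq_mul_div, div_le_div_iff_of_pos_right hg]
      have h1 : |hj| ≤ H := abs_le.2 ⟨hjmem.1, hjmem.2⟩
      have h2 : |hL'| ≤ H := habs
      have h3 : hj ^ 2 - hL' ^ 2 = (hj + hL') * (hj - hL') := by ring
      rw [h3]
      have h4 : |hj + hL'| ≤ 2 * H := (abs_add_le _ _).trans (by linarith)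
      have h5 : |hj - hL'| ≤ s := by rw [abs_sub_comm, abs_of_nonneg hj0]; exact hjs
      calc (hj + hL') * (hj - hL') ≤ |(hj + hL') * (hj - hL')| := le_abs_self _
        _ = |hj + hL'| * |hj - hL'| := abs_mul _ _
        _ ≤ 2 * H * s := mul_le_mul h4 h5 (abs_nonneg _) (by positivity)
    have hQj : Q hj ≤ b := hQb hj hjmem
    have hQj' : Q hj = q hj - hj ^ 2 / g := rfl
    have e1 := (abs_le.1 eLip).2
    have e2 := (abs_le.1 egrid).2
    have hCs : C * (hL' - hj) ≤ C * s := mul_le_mul_of_nonneg_left hjs hC0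
    linarith [hsmall, e1, e2, hQj, hsqdiff, hCs, hhL']
  rw [abs_le]
  exact ⟨by linarith, by linarith⟩

/-- **Registered bridge stub** (binder-free form of `tw_seededPressureLimit_of_sourcedLimit`, the shape recorded on
the item by `stub-add`): AHM at `(U, μ, β, g)` + thermodynamic limit of the sourced pressure on `|h| ≤ 13g + 1` ⟹
thermodynamic limit of the seeded pressure. [folklore] -/
theorem stub_seededLimit_of_sourcedLimit :
    ∀ (U g β μ : ℝ) (q : ℝ → ℝ), 0 < β → 0 < g → ((∀ (L : ℕ) [NeZero L] (h : ℝ), (Real.log (Matrix.partitionFn β (Literature.MathematicalPhysics.QuantumLattice.dWaveSourceTorus L U μ h)).re / (β * (L : ℝ) ^ 2)) - h ^ 2 / g ≤ (Real.log (Matrix.partitionFn β (Literature.MathematicalPhysics.QuantumLattice.hubbardTorusWith 2 L 1 U μ - ((g / (L : ℝ) ^ 2 : ℝ) : ℂ) • ((Literature.MathematicalPhysics.QuantumLattice.pairField Literature.MathematicalPhysics.QuantumLattice.dWaveFormFactor L)ᴴ * Literature.MathematicalPhysics.QuantumLattice.pairField Literature.MathematicalPhysics.QuantumLattice.dWaveFormFactor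 L))).re / (β * (L : ℝ) ^ 2))) ∧ (∀ ε : ℝ, 0 < ε → ∃ L₀ : ℕ, ∀ (L : ℕ) [NeZero L], L₀ ≤ L → ∃ h : ℝ, (Real.log (Matrix.partitionFn β (Literature.MathematicalPhysics.QuantumLattice.hubbardTorusWith 2 L 1 U μ - ((g / (L : ℝ) ^ 2 : ℝ) : ℂ) • ((Literature.MathematicalPhysics.QuantumLattice.pairField Literature.MathematicalPhysics.QuantumLattice.dWaveFormFactor L)ᴴ * Literature.MathematicalPhysics.QuantumLattice.pairField Literature.MathematicalPhysics.QuantumLattice.dWaveFormFactor L))).re / (β * (L : ℝ) ^ 2)) ≤ (Real.log (Matrix.partitionFn β (Literature.MathematicalPhysics.QuantumLattice.dWaveSourceTorus L U μ h)).re / (β * (L : ℝ) ^ 2)) - h ^ 2 / g + ε)) → (∀ h ∈ Set.Icc (-(13 * g + 1)) (13 * g + 1), ∀ κ : ℝ, 0 < κ → ∃ L₀ : ℕ, ∀ (L : ℕ) [NeZero L], L₀ ≤ L → |Real.log (Matrix.partitionFn β (Literature.MathematicalPhysics.QuantumLattice.dWaveSourceTorus L U μ h)).re / (β * (L : ℝ)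 ^ 2) - q h| ≤ κ) → ∀ κ : ℝ, 0 < κ → ∃ L₀ : ℕ, ∀ (L : ℕ) [NeZero L], L₀ ≤ L → |Real.log (Matrix.partitionFn β (Literature.MathematicalPhysics.QuantumLattice.hubbardTorusWith 2 L 1 U μ - ((g / (L : ℝ) ^ 2 : ℝ) : ℂ) • ((Literature.MathematicalPhysics.QuantumLattice.pairField Literature.MathematicalPhysics.QuantumLattice.dWaveFormFactor L)ᴴ * Literature.MathematicalPhysics.QuantumLattice.pairField Literature.MathematicalPhysics.QuantumLattice.dWaveFormFactor L))).re / (β * (L : ℝ) ^ 2) - sSup ((fun h : ℝ => q h - h ^ 2 / g) '' Set.Icc (-(13 * g + 1)) (13 * g + 1))| ≤ κ := by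
  intro U g β μ q hβ hg hAHM hsl
  exact tw_seededPressureLimit_of_sourcedLimit U g β μ q hβ hg hAHM hsl

end

end Summit.HubbardSuperconductivity.HubbardSuperconductivity.Theorems.TwSeededEnsembleEquivalence.ThermalDuality
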